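import Literature.MathematicalPhysics.QuantumFieldTheory.Balaban1983to89.NodeOFlatTransfer

/-!
# `Balaban1983to89.NodeOFlatAxial` — T. Bałaban, *Propagators for lattice gauge theories in a background field*, CMP **99** (1985) 389–434
# [Balaban1985BackgroundPropagators] p. 428 («We have proved it in [4], Lemma 2.4, for operators with U = 1») with [Balaban1984PropagatorsII] Lemma 2.4 (2.128)
# p. 245 and (3.35)–(3.36) p. 396: **LEMMA 2.4′ IN THE WEIGHTED `L²` CURRENCY — the flat axial coercivity `hflat`: `γ_f‖A‖² ≤ ‖∂A‖² + a‖Q(1)A‖²` for `W`-valued `A`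
# vanishing on `T` and outside a window of blocks, FROM the unit-weight torus (2.128), with `γ_f = k·min{η⁻², a·c₁∕(c₀·w_Q)}` EXPLICIT** (`RW` ⟸ `Rreal` ⟸ (2.128))

statement-level skeleton of published theorems with citation tags; proofs where landed; nothing here is a claim about the Yang–Mills mass gap

CITATION HEADER (lean-in-tree rule).  Ideation cell `ym-nodeO-ideate` (portfolio track, 2026-08-25), seat P1 «inside Bałaban», memo
`memos/ROUTE-P1.md` v3.17 (sha256 d4d6d9a6…) §0q (FINDINGS F10∕F11) and §0p (F9).  LANDING EDITION (generation 12, F-series module 4∕5) of the memo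
companion `memos/ROUTE-P1-SketchFlatQ.lean` («companion 7», sha256 a5130964…) §5–§6 (lines 266–414); referee track = the cell's `STATUS.md` (REF∕LIT verdict lines on v3.17 and on this edition are the filing precondition; the courier files
REF-named editions only, unchanged; director-ym LINE №2 (B), operator 2026-08-25T18:24:34Z).  Statements and proofs below are CHARACTER-IDENTICAL to the
companion's; edition deltas = the namespace (`YMNodeOIdeate.P1.FlatQ` → this module's), this header, the imports of module 3 `NodeOFlatTransfer` (companion §1–§4, reached by `open NodeOFlatTransfer`) and module 1 (`curlSum`∕`qSum`), the companion's `variable` block repeated verbatim, the companion's `open …Balaban1983to89` line dropped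
(the opens now resolve inside the tree namespace), bare `Plaq`∕`block` spelled `B9SectCLatticeCarrier.Plaq`∕`B6Elimination.block` in code (inside the tree
namespace the topic root's `Setup.lean` `Plaq`∕`block` shadow the opens),
for the gate lint `literature-cited-only` (LIT pre-flight 2026-08-25T20:35:30Z: `[folklore]` alone only on private helpers) 4 same-module helper(s) marked `private`
(`sum_plaqSgn_mul`, `sum_plaqSgn_smul`, `sum_qBond_mul`, `sum_qBond_smul`), and nothing else.  EACH `[cite:]` TAG NAMES THE PRINTED DISPLAY THE DECLARATION SERVES OR TRANSCRIBES —
the proofs are finite-sum bookkeeping ∕ linear algebra of ours; print proves none of them as stated.  Sources READ (renders, LIT `lit/SOURCES.md` v2.75):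
[Balaban1985BackgroundPropagators] pp. 391–396, p. 428; [Balaban1984PropagatorsII] = CMP **96** p. 245.

PRINT STATUS.  Lemma 2.4′ (Lemma 2.4 at `U = 1` in the norms of [Balaban1985BackgroundPropagators] (3.26)–(3.27), weights `c₀`, `c₁`, curl scale `η⁻¹`) is ASSERTED
BY REFERENCE on p. 428 and displayed nowhere; the written repair `pub-balaban/b2b-balaban-r1/SectE-interface-proof.md` (E1) Lemma 5.5 consumes it as (π9).  Below it is
a theorem GIVEN the unit-weight torus (2.128) as a binder (`Rreal_of_unitWeight` + `hflat_of_Rreal`); module 2 `NodeOTorusLemma24.torus2128_of_Zd` inhabits that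
binder for `T ⊇` the block axial trees, and module 5 `NodeOLocAxial` composes.

WHAT IS PROVED (sorry-free; standard axioms).  §5 `plaqBond`∕`plaqSgn`∕`qBond` and their sum lemmas, `RW_of_Rreal`, **`hflat_of_Rreal`** (`hflat(γ_f)` ⟸ the REAL
explicit-sum inequality `Rreal(γ_f)`: `γ_f·c₀·Σ_{b : block ∈ Y} B_b² ≤ c₀η⁻²·Σ_p curlSum² + a·c₁·L^{−2(d+1)}·Σ_c qSum²` for real `B` vanishing on `T` and off `Y`);
§6 **`Rreal_of_unitWeight`** (`Rreal(min(c₀η⁻², a·c₁∕w_Q)·k∕c₀)` ⟸ the unit-weight form `k·Σ_b B² ≤ w_Q·Σ_c (L^{−(d+1)}qSum)² + Σ_p curlSum²`, `0 ≤ a`, `0 < w_Q`).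

WHAT THIS IS NOT.  Not NODE O (`B13TermWalkDataOneTorus.ExistsUniformAcrossSmall`, :353), not [Balaban1987RG1] Thm 2 + (0.31) p. 259, not the `γ₀`
sentence of [Balaban1985BackgroundPropagators] p. 428 (whose road is `NodeOGamma0Road.hcoer_of_letters` MODULO its letters), not a new estimate: no statement about `U ≠ 1` (that is module 5), none for `T` smaller than the hypothesis of the (2.128) binder supplied.
-/

noncomputable section

open scoped BigOperators InnerProductSpace

namespace Literature.MathematicalPhysics.QuantumFieldTheory.Balaban1983to89.NodeOFlatAxial

open B4Sect5Torus (TSite)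
open B9SectCLatticeCarrier (Bond Plaq shift bpos)
open B7Prop1Explicit (e boxVec seg asum asum_seg_natCast U1 Wcx)
open B7Prop3Flat (linQ)
open B7Prop3GeneralLinear (linQcov linQcov_one_left)
open B9Eq311L2Pairing (WL2)
open B11Eq103H1Complex (BondL2K)
open B9Eq310HessianOperator (PlaqL2K covCurlL2K equiv_covCurlL2K adTransportW)
open B9Eq34CovCurlVector (covCurl covCurl_apply_coord)
open B9Eq319QprimeTorus (fineP blockCoord)
open B9Eq315QTorusOnto (liftSite)
open B9Eq315QTorus (perSite perCfg perCfg_apply cornerSite QtorusLin QtorusLin_apply QtorusW QtorusW_apply)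
open B5Eq155FlatAveragingCommute (perCfg_one norm_perCfg_le adTransportW_flat)
open NodeOTorusBlocks (curlSum qSum)
open NodeOFlatTransfer

variable {d : ℕ}
variable {𝔸 : Type*} [NormedRing 𝔸] [NormedAlgebra ℂ 𝔸] [CompleteSpace 𝔸] [NormOneClass 𝔸]
  (L : ℕ) [NeZero L] (m : Fin d → ℕ) [∀ i, NeZero (fineP L m i)] (hL : 1 ≤ L)
  {W : Type*} [NormedAddCommGroup W] [InnerProductSpace ℂ W] (φ : W ≃ₗ[ℂ] 𝔸) {c₀ c₁ : ℝ} [Fact (0 < c₀)] [Fact (0 < c₁)]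
  {α : ℝ} (hα1 : α ≤ 1 / 64)
  (hU1 : ∀ (x : B7Prop1Explicit.Site d) (κ : Fin d), perCfg (fineP L m) (fun _ : Bond d (fineP L m) => (1 : 𝔸ˣ)) x κ ∈ U1 𝔸)
  (hreg : ∀ (y : TSite d m) (κ : Fin d) (r : Fin d → Fin L),
    ‖((Wcx L (perCfg (fineP L m) (fun _ : Bond d (fineP L m) => (1 : 𝔸ˣ))) (cornerSite L y) κ (boxVec L r) : 𝔸ˣ) : 𝔸) - 1‖ ≤ α)


/-! ## §5  `RW` ⟸ `Rreal`: the explicit-sum inequality transfers from REAL to `W`-valued bond functions (D4 applied with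
the four signed plaquette bonds and the `L^d·L` sites of the (2.125) double sum as the two families of linear forms). -/

section RealToW

variable {P : Fin d → ℕ}

/-- The four bonds of the plaquette `p = (x, μ<ν)` in the order `(x+e_μ, ν), (x, ν), (x+e_ν, μ), (x, μ)`. [folklore] -/
def plaqBond (p : B9SectCLatticeCarrier.Plaq d P) : Fin 4 → Bond d P :=
  ![(shift p.2.1.1 p.1, p.2.1.2), (p.1, p.2.1.2), (shift p.2.1.2 p.1, p.2.1.1), (p.1, p.2.1.1)]

/-- Their signs `+1, −1, −1, +1` in `curlSum`. [folklore] -/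
def plaqSgn : Fin 4 → ℝ := ![1, -1, -1, 1]

/-- `curlSum` as the signed sum over the four bonds (real values). [folklore] -/
private theorem sum_plaqSgn_mul (B : Bond d P → ℝ) (p : B9SectCLatticeCarrier.Plaq d P) :
    ∑ k, plaqSgn k * B (plaqBond p k) = curlSum B p := by
  simp [Fin.sum_univ_four, plaqSgn, plaqBond, curlSum]
  ring

/-- `curlSum` as the signed sum over the four bonds (fibre values). [folklore] -/
private theorem sum_plaqSgn_smul {V : Type*} [AddCommGroup V] [Module ℂ V] (F : Bond d P → V) (p : B9SectCLatticeCarrier.Plaq d P) :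
    ∑ k, ((plaqSgn k : ℝ) : ℂ) • F (plaqBond p k) = curlSum F p := by
  simp [Fin.sum_univ_four, plaqSgn, plaqBond, curlSum]
  abel

/-- The fine bond `(⟨L·y + r + i·e_κ⟩_per, κ)` of the (2.125) double sum, indexed by `(r, i)`. [cite: Balaban1984PropagatorsII, (2.125) p.245] -/
def qBond (c : Bond d m) (ri : (Fin d → Fin L) × ℕ) : Bond d (fineP L m) :=
  (perSite (fineP L m) (cornerSite L c.1 + boxVec L ri.1 + (ri.2 : ℤ) • e c.2), c.2)

omit [NeZero L] in
/-- `qSum` as a single sum over `[0,L)^d × [0,L)` (real values). [folklore] -/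
private theorem sum_qBond_mul (B : Bond d (fineP L m) → ℝ) (c : Bond d m) :
    ∑ ri ∈ (Finset.univ : Finset (Fin d → Fin L)) ×ˢ Finset.range L, (1 : ℝ) * B (qBond L m c ri) = qSum L m B c := by
  rw [Finset.sum_product]
  simp only [one_mul]
  rfl

omit [NeZero L] in
/-- `qSum` as a single sum over `[0,L)^d × [0,L)` (fibre values). [folklore] -/
private theorem sum_qBond_smul {V : Type*} [AddCommGroup V] [Module ℂ V] (F : Bond d (fineP L m) → V) (c : Bond d m) :
    ∑ ri ∈ (Finset.univ : Finset (Fin d → Fin L)) ×ˢ Finset.range L, (((1 : ℝ) : ℝ) : ℂ) • F (qBond L m c ri) = qSum L m F c := by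
  rw [Finset.sum_product]
  simp only [Complex.ofReal_one, one_smul]
  rfl

variable [FiniteDimensional ℂ W]

omit [NeZero L] [Fact (0 < c₀)] [Fact (0 < c₁)] in
/-- **`RW` ⟸ `Rreal` (D4 instantiated).**  If the explicit-sum inequality holds for every REAL bond function vanishing on `T`
and on the bonds starting outside the blocks of `Y`, it holds — same constant — for every `W`-valued one.
[cite: Balaban1984PropagatorsII, Lemma 2.4 (2.128) p.245] -/
theorem RW_of_Rreal (η : ℝ) {ρ : ℕ} (T : Set (Bond d (fineP L m))) {a γf : ℝ}
    (hRreal : ∀ (y₁ : TSite d m) (Y : Set (TSite d m)),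
      (∀ y ∈ Y, ∀ i, 1 ≤ liftSite (y - y₁) i ∧ liftSite (y - y₁) i ≤ ((2 * ρ : ℕ) : ℤ) + 1) →
      ∀ B : Bond d (fineP L m) → ℝ, (∀ b ∈ T, B b = 0) → (∀ b, blockCoord L m (bpos b) ∉ Y → B b = 0) →
        γf * (c₀ * ∑ b, B b ^ 2) ≤
          c₀ * η⁻¹ ^ 2 * ∑ p, curlSum B p ^ 2 + a * c₁ * ((L : ℝ) ^ (d + 1))⁻¹ ^ 2 * ∑ c, qSum L m B c ^ 2) :
    ∀ (y₁ : TSite d m) (Y : Set (TSite d m)),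
      (∀ y ∈ Y, ∀ i, 1 ≤ liftSite (y - y₁) i ∧ liftSite (y - y₁) i ≤ ((2 * ρ : ℕ) : ℤ) + 1) →
      ∀ F : Bond d (fineP L m) → W, (∀ b ∈ T, F b = 0) → (∀ b, blockCoord L m (bpos b) ∉ Y → F b = 0) →
        γf * (c₀ * ∑ b, ‖F b‖ ^ 2) ≤
          c₀ * η⁻¹ ^ 2 * ∑ p, ‖curlSum F p‖ ^ 2 + a * c₁ * ((L : ℝ) ^ (d + 1))⁻¹ ^ 2 * ∑ c, ‖qSum L m F c‖ ^ 2 := by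
  intro y₁ Y hY F hT hY0
  have h := quadIneq_transfer₂ (V := W) (Finset.univ : Finset (Bond d (fineP L m)))
    {b | b ∈ T ∨ blockCoord L m (bpos b) ∉ Y} (γf * c₀)
    (Finset.univ : Finset (B9SectCLatticeCarrier.Plaq d (fineP L m))) (fun _ => c₀ * η⁻¹ ^ 2) (fun _ => Finset.univ) (fun _ k => plaqSgn k)
      (fun p k => plaqBond p k)
    (Finset.univ : Finset (Bond d m)) (fun _ => a * c₁ * ((L : ℝ) ^ (d + 1))⁻¹ ^ 2)
      (fun _ => (Finset.univ : Finset (Fin d → Fin L)) ×ˢ Finset.range L) (fun _ _ => (1 : ℝ)) (fun c ri => qBond L m c ri)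
    (fun B hB => by
      have h0 := hRreal y₁ Y hY B (fun b hb => hB b (Or.inl hb)) (fun b hb => hB b (Or.inr hb))
      simp only [sum_plaqSgn_mul, sum_qBond_mul]
      simp only [← Finset.mul_sum]
      simpa only [← mul_assoc] using h0)
    F (fun b hb => hb.elim (hT b) (hY0 b))
  simp only [sum_plaqSgn_smul, sum_qBond_smul] at h
  simp only [← Finset.mul_sum] at h
  simpa only [← mul_assoc] using h

omit [NeZero L] in
/-- **J1a's residue after this file: `hflat` ⟸ `Rreal`** — the `hflat` binder of companion 6 (`hloc_axial_of_flat₀`) follows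
from the explicit REAL finite-sum inequality `Rreal` on the torus (curl sums over plaquettes, (2.125) double sums over
coarse bonds, real bond functions vanishing on `T` and outside the blocks of a box `Y`).  What remains (D5/D6, for the
next generation): `Rreal` with `γ_f = (κ₁/(12d²))·L^{−(d+1)}·min{η⁻²... }` — precisely: `Rreal` ⟸ the tree's `ℤ^d` theorem
`B6Lemma24Kappa.lemma24_printedShape18_kappa1` by lifting the box `Y` to `ℤ^d` (no wrap since `2ρ + 4 ≤ m_i`).
[cite: Balaban1984PropagatorsII, Lemma 2.4 (2.128) p.245; Balaban1985BackgroundPropagators, (3.35)–(3.36) p.396] -/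
theorem hflat_of_Rreal (η : ℝ) {ρ : ℕ} (T : Set (Bond d (fineP L m))) {a γf : ℝ} (ha : 0 ≤ a)
    (hRreal : ∀ (y₁ : TSite d m) (Y : Set (TSite d m)),
      (∀ y ∈ Y, ∀ i, 1 ≤ liftSite (y - y₁) i ∧ liftSite (y - y₁) i ≤ ((2 * ρ : ℕ) : ℤ) + 1) →
      ∀ B : Bond d (fineP L m) → ℝ, (∀ b ∈ T, B b = 0) → (∀ b, blockCoord L m (bpos b) ∉ Y → B b = 0) →
        γf * (c₀ * ∑ b, B b ^ 2) ≤
          c₀ * η⁻¹ ^ 2 * ∑ p, curlSum B p ^ 2 + a * c₁ * ((L : ℝ) ^ (d + 1))⁻¹ ^ 2 * ∑ c, qSum L m B c ^ 2) :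
    ∀ (y₁ : TSite d m) (Y : Set (TSite d m)),
      (∀ y ∈ Y, ∀ i, 1 ≤ liftSite (y - y₁) i ∧ liftSite (y - y₁) i ≤ ((2 * ρ : ℕ) : ℤ) + 1) →
      ∀ A' : BondL2K ℂ d (fineP L m) c₀ W, (∀ b ∈ T, WL2.equiv ℂ _ W A' b = 0) →
        (∀ b : Bond d (fineP L m), blockCoord L m (bpos b) ∉ Y → WL2.equiv ℂ _ W A' b = 0) →
        γf * ‖A'‖ ^ 2 ≤ ‖covCurlL2K ℂ c₀ ((η : ℂ))⁻¹ (adTransportW φ fun _ : Bond d (fineP L m) => (1 : 𝔸ˣ)) A'‖ ^ 2 +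
          ‖((Real.sqrt a : ℝ) : ℂ) • QtorusW L m hL φ (fun _ : Bond d (fineP L m) => (1 : 𝔸ˣ)) hα1 hU1 hreg (c₁ := c₁) A'‖ ^ 2 :=
  hflat_of_RW L m hL φ hα1 hU1 hreg η T ha (RW_of_Rreal L m η T hRreal)

end RealToW

/-! ## §6  The constant: `Rreal(γ_f)` ⟸ the UNIT-WEIGHT torus form of (2.128)
`k·Σ_b B_b² ≤ w_Q·Σ_c (L^{−(d+1)}·qSum)² + Σ_p curlSum²` (the shape the `ℤ^d` theorem delivers after the lift, with
`k = (κ₁/(12d²))·L^{−(d+1)}`, `w_Q = L^{d−2}`), by the scaling `θ = min{c₀η⁻², a·c₁/w_Q}`: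
`γ_f = θ·k/c₀ = k·min{η⁻², a·c₁/(c₀·w_Q)}` — the memo's `γ_f` (§0p.3) with `λ_{d,L} = 1`. -/

section Constant

omit [NeZero L] in
/-- **`Rreal(θ·k/c₀)` ⟸ torus-(2.128) with constant `k` and `Q`-weight `w_Q > 0`.** [cite: Balaban1984PropagatorsII, Lemma 2.4 (2.128) p.245; Balaban1985BackgroundPropagators, (3.35)–(3.36) p.396] -/
theorem Rreal_of_unitWeight (η : ℝ) {ρ : ℕ} (T : Set (Bond d (fineP L m))) {a k wQ : ℝ} (ha : 0 ≤ a) (hwQ : 0 < wQ)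
    (h2128 : ∀ (y₁ : TSite d m) (Y : Set (TSite d m)),
      (∀ y ∈ Y, ∀ i, 1 ≤ liftSite (y - y₁) i ∧ liftSite (y - y₁) i ≤ ((2 * ρ : ℕ) : ℤ) + 1) →
      ∀ B : Bond d (fineP L m) → ℝ, (∀ b ∈ T, B b = 0) → (∀ b, blockCoord L m (bpos b) ∉ Y → B b = 0) →
        k * ∑ b, B b ^ 2 ≤
          wQ * ∑ c, (((L : ℝ) ^ (d + 1))⁻¹ * qSum L m B c) ^ 2 + ∑ p, curlSum B p ^ 2) :
    ∀ (y₁ : TSite d m) (Y : Set (TSite d m)),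
      (∀ y ∈ Y, ∀ i, 1 ≤ liftSite (y - y₁) i ∧ liftSite (y - y₁) i ≤ ((2 * ρ : ℕ) : ℤ) + 1) →
      ∀ B : Bond d (fineP L m) → ℝ, (∀ b ∈ T, B b = 0) → (∀ b, blockCoord L m (bpos b) ∉ Y → B b = 0) →
        min (c₀ * η⁻¹ ^ 2) (a * c₁ / wQ) * k / c₀ * (c₀ * ∑ b, B b ^ 2) ≤
          c₀ * η⁻¹ ^ 2 * ∑ p, curlSum B p ^ 2 + a * c₁ * ((L : ℝ) ^ (d + 1))⁻¹ ^ 2 * ∑ c, qSum L m B c ^ 2 := by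
  intro y₁ Y hY B hT hY0
  have h := h2128 y₁ Y hY B hT hY0
  have hc₀ : 0 < c₀ := Fact.out
  set θ : ℝ := min (c₀ * η⁻¹ ^ 2) (a * c₁ / wQ) with hθ
  set X : ℝ := ∑ c, (((L : ℝ) ^ (d + 1))⁻¹ * qSum L m B c) ^ 2 with hX
  set Y' : ℝ := ∑ p, curlSum B p ^ 2 with hY'
  have hX0 : 0 ≤ X := Finset.sum_nonneg fun _ _ => sq_nonneg _
  have hY0' : 0 ≤ Y' := Finset.sum_nonneg fun _ _ => sq_nonneg _
  have hc₁ : 0 < c₁ := Fact.out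
  have hθ0 : 0 ≤ θ := le_min (mul_nonneg hc₀.le (sq_nonneg _)) (div_nonneg (mul_nonneg ha hc₁.le) hwQ.le)
  have hθ1 : θ ≤ c₀ * η⁻¹ ^ 2 := min_le_left _ _
  have hθ2 : θ * wQ ≤ a * c₁ := (le_div_iff₀ hwQ).1 (min_le_right _ _)
  have hXe : ((L : ℝ) ^ (d + 1))⁻¹ ^ 2 * ∑ c, qSum L m B c ^ 2 = X := by
    rw [hX, Finset.mul_sum]
    exact Finset.sum_congr rfl fun c _ => by ring
  calc θ * k / c₀ * (c₀ * ∑ b, B b ^ 2) = θ * (k * ∑ b, B b ^ 2) := by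
        field_simp
    _ ≤ θ * (wQ * X + Y') := mul_le_mul_of_nonneg_left h hθ0
    _ = θ * wQ * X + θ * Y' := by ring
    _ ≤ a * c₁ * X + c₀ * η⁻¹ ^ 2 * Y' :=
        add_le_add (mul_le_mul_of_nonneg_right hθ2 hX0) (mul_le_mul_of_nonneg_right hθ1 hY0')
    _ = c₀ * η⁻¹ ^ 2 * ∑ p, curlSum B p ^ 2 + a * c₁ * ((L : ℝ) ^ (d + 1))⁻¹ ^ 2 * ∑ c, qSum L m B c ^ 2 := by
        rw [mul_assoc (a * c₁), hXe, add_comm]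

end Constant

end Literature.MathematicalPhysics.QuantumFieldTheory.Balaban1983to89.NodeOFlatAxial

end
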